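import Literature.Algebra.Homology.ExtPresentationObstruction
import HarnessLib

/-!
# The IMAGE of the degree-`2` obstruction `Ψ : Hom(N₁, X₃) → Ext²(N, X₁)`: a class `x` is an obstruction
# as soon as (A) it dies on `P` and (B) its dimension shift `y ∈ Ext¹(N₁, X₁)` dies in `Ext¹(N₁, X₂)`
# (the degree-two chase completing chl-p2 g6's `ExtPresentationObstruction`)

Topic `Algebra/Homology`; namespace `Literature.Algebra.Homology.ExtPresentation`.  Theorems only, for Mathlib's
`Abelian.Ext` in any abelian category with `HasExt`; no definition, no named fact, no instance, no `sorry`.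
Sequel of `ExtPresentationObstruction` (cell bsd-wall, chl-p2 g6: `obstruction hS hT h = [S] ∘ h ∘ [T]`, its kernel
when `Ext¹(P, X₁) = 0`, and `§4`: `Ψ` lands in `Ker(Ext²(N, X₁) → Ext²(P, X₁)) ∩ Ker(Ext²(N, X₁) → Ext²(N, X₂))`).

THE MATHEMATICS (Cartan–Eilenberg / Weibel, dimension shifting in both variables).  `S : 0 → N₁ —ι→ P —π→ N → 0`
and `T : 0 → X₁ —f→ X₂ —g→ X₃ → 0` short exact, `x ∈ Ext²(N, X₁)`.
* (A) **`x ∘ π = 0` in `Ext²(P, X₁)`** ⟺ `x = [S] ∘ y` for some `y ∈ Ext¹(N₁, X₁)` (contravariant exactness of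
  `Ext¹(N₁, X₁) → Ext²(N, X₁) → Ext²(P, X₁)`, Mathlib `Ext.contravariant_sequence_exact₃`);
* (B) **`y ∘ f = 0` in `Ext¹(N₁, X₂)`** ⟺ `y = h ∘ [T]` for some `h : N₁ → X₃` (covariant exactness of
  `Hom(N₁, X₃) → Ext¹(N₁, X₁) → Ext¹(N₁, X₂)`, Mathlib `Ext.covariant_sequence_exact₁`);
and then `x = [S] ∘ h ∘ [T] = Ψ(h)`.  So **`x ∈ Im Ψ` as soon as (A) holds and (B) holds for every (equivalently:
one, when `Ext¹(P, X₁) = 0`) dimension shift `y` of `x`** (`exists_obstruction_eq_of_shift`,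
`exists_obstruction_eq_of_exists_shift`); conversely both conditions are necessary
(`mk₀_g_comp_obstruction`, `obstruction_comp_mk₀_f` of the previous file, and `shift_obstruction_comp_mk₀_f` here).
With `Ext¹(P, X₁) = 0` the shift `y` is unique (`shift_unique`), so (B) is a condition on `x` alone.

USE (property (e) `Ш²(K, M^D) ⊆ Im Ψ` of the `Ш²`-readout road to `poitouTate_sha_tateDual`, cell bsd-wall
`PoitouTateShaTwoReadout.poitouTate_sha_tateDual_of_shaTwoObstruction`, hypothesis `hΨsurj`): `S` = door-c4's
presentation of `M`, `T` = door-c5's `0 → F̄ˣ → J̄ → C̄ → 0`, `x ↔ c ∈ Ш²(K, M^D)` under `HomDual.extTwoToTateDual`;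
(A) = "`c` dies on the permutation lattice `P`" (Brauer–Hasse–Noether for the trivialising layer, Shapiro in degree 2);
(B) = "the locally trivial torus class `y ∈ Ext¹(N₁, F̄ˣ) = H¹(K, T_{N₁})` dies in `Ext¹(N₁, J̄)`" (this seat's
`IdeleReadout.exists_comp_eq_unitsToIdele_of_localExtensions` + `boundary_eq_zero_iff`).
HONEST FRAMING: homological algebra only; no arithmetic statement is proved here.

## References
* C. A. Weibel, *An introduction to homological algebra* (1994), §2.7, Thm. 2.7.6, §3.4. [Weibel1994]
* J. S. Milne, *Arithmetic Duality Theorems* (2nd ed. 2006), I §4, proof of Theorem 4.10 (a) (p. 58: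
  `Ш²(K, M) = Ker(Ext²(M^D, K̄ˣ) → Ext²(M^D, J̄))`). [MilneADT2006]
-/

noncomputable section

universe w v u

namespace Literature.Algebra.Homology

namespace ExtPresentation

open CategoryTheory CategoryTheory.Abelian

variable {C : Type u} [Category.{v} C] [Abelian C] [HasExt.{w} C]
  {S : ShortComplex C} (hS : S.ShortExact) {T : ShortComplex C} (hT : T.ShortExact)

/-! ## §1 Dimension shifts of a class of `Ext²(N, X₁)` along the presentation -/

/-- **(A) ⟹ a dimension shift exists**: if `x ∘ π = 0` in `Ext²(P, X₁)` then `x = [S] ∘ y` for some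
`y ∈ Ext¹(N₁, X₁)`. [cite: Weibel1994, Theorem 2.7.6] -/
theorem exists_shift_of_mk₀_g_comp_eq_zero {X : C} (x : Ext S.X₃ X 2)
    (hA : (Ext.mk₀ S.g).comp x (zero_add 2) = 0) :
    ∃ y : Ext S.X₁ X 1, hS.extClass.comp y (rfl : 1 + 1 = 2) = x :=
  Ext.contravariant_sequence_exact₃ (hS := hS) (Y := X) x hA (n₀ := 1) rfl

/-- Conversely a shifted class dies on `P`: `([S] ∘ y) ∘ π = 0`. [cite: Weibel1994, Theorem 2.7.6] -/
theorem mk₀_g_comp_extClass_comp {X : C} (y : Ext S.X₁ X 1) :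
    (Ext.mk₀ S.g).comp (hS.extClass.comp y (rfl : 1 + 1 = 2)) (zero_add 2) = 0 := by
  rw [← Ext.comp_assoc (Ext.mk₀ S.g) hS.extClass y (zero_add 1) rfl (by omega), hS.comp_extClass, Ext.zero_comp]

include hS in
/-- **When `Ext¹(P, X₁) = 0` the dimension shift is unique**: `[S] ∘ –` is injective on `Ext¹(N₁, X₁)`.
[cite: Weibel1994, Theorem 2.7.6] -/
theorem shift_unique {X : C} (hP : ∀ z : Ext S.X₂ X 1, z = 0) {y y' : Ext S.X₁ X 1}
    (h : hS.extClass.comp y (rfl : 1 + 1 = 2) = hS.extClass.comp y' (rfl : 1 + 1 = 2)) : y = y' := by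
  have h2 : hS.extClass.comp (y - y') (rfl : 1 + 1 = 2) = 0 := by
    rw [sub_eq_add_neg, Ext.comp_add, Ext.comp_neg, h, add_neg_cancel]
  obtain ⟨x₂, hx₂⟩ := Ext.contravariant_sequence_exact₁ (hS := hS) (Y := X) (y - y') (rfl : 1 + 1 = 2) h2
  have h3 : y - y' = 0 := by rw [← hx₂, hP x₂, Ext.comp_zero]
  exact sub_eq_zero.1 h3

/-! ## §2 The image of the obstruction map -/

/-- **The dimension shift of an obstruction is `h ∘ [T]`**: `Ψ(h) = [S] ∘ (h ∘ [T])`.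
[cite: Weibel1994, §3.4] -/
theorem obstruction_eq_extClass_comp (h : S.X₁ ⟶ T.X₃) :
    obstruction hS hT h = hS.extClass.comp ((Ext.mk₀ h).comp hT.extClass (zero_add 1)) (rfl : 1 + 1 = 2) :=
  rfl

/-- The shift `h ∘ [T]` of an obstruction dies in `Ext¹(N₁, X₂)` (condition (B) is necessary).
[cite: Weibel1994, Theorem 2.7.6] -/
theorem shift_obstruction_comp_mk₀_f (h : S.X₁ ⟶ T.X₃) :
    ((Ext.mk₀ h).comp hT.extClass (zero_add 1)).comp (Ext.mk₀ T.f) (add_zero 1) = 0 := by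
  rw [Ext.comp_assoc_of_third_deg_zero, hT.extClass_comp, Ext.comp_zero]

/-- **(B) for a shift ⟹ it is `h ∘ [T]`**: if `y ∘ f = 0` in `Ext¹(N₁, X₂)` then `y = h ∘ [T]` for some
`h : N₁ → X₃`. [cite: Weibel1994, Theorem 2.7.6] -/
theorem exists_mk₀_comp_extClass_eq_of_comp_mk₀_f_eq_zero (y : Ext S.X₁ T.X₁ 1)
    (hB : y.comp (Ext.mk₀ T.f) (add_zero 1) = 0) :
    ∃ h : S.X₁ ⟶ T.X₃, (Ext.mk₀ h).comp hT.extClass (zero_add 1) = y := by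
  obtain ⟨x₃, hx₃⟩ := Ext.covariant_sequence_exact₁ (hS := hT) (X := S.X₁) y hB (n₀ := 0) (zero_add 1)
  exact ⟨Ext.addEquiv₀ x₃, by rw [Ext.mk₀_addEquiv₀_apply, hx₃]⟩

/-- **THE DEGREE-TWO CHASE, image form.**  A class `x ∈ Ext²(N, X₁)` with a dimension shift `y ∈ Ext¹(N₁, X₁)`
(`x = [S] ∘ y`; exists iff (A) `x ∘ π = 0`) such that (B) `y ∘ f = 0` in `Ext¹(N₁, X₂)` IS an obstruction:
`x = Ψ(h)` for some `h : N₁ → X₃`.  In Milne's proof of I 4.10 (a): `Ker(Ext²(M^D, K̄ˣ) → Ext²(M^D, J̄)) ⊆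
Im(Ext¹(M^D, C̄) → Ext²(M^D, K̄ˣ))`, at the level of homomorphisms out of the relation module.
[cite: MilneADT2006, I Theorem 4.10 (proof)] [cite: Weibel1994, Theorem 2.7.6] -/
theorem exists_obstruction_eq_of_shift (x : Ext S.X₃ T.X₁ 2) (y : Ext S.X₁ T.X₁ 1)
    (hy : hS.extClass.comp y (rfl : 1 + 1 = 2) = x) (hB : y.comp (Ext.mk₀ T.f) (add_zero 1) = 0) :
    ∃ h : S.X₁ ⟶ T.X₃, obstruction hS hT h = x := by
  obtain ⟨h, hh⟩ := exists_mk₀_comp_extClass_eq_of_comp_mk₀_f_eq_zero hT y hB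
  exact ⟨h, by rw [obstruction_eq_extClass_comp, hh, hy]⟩

/-- The same with (A) as hypothesis and (B) required of EVERY shift. [cite: MilneADT2006, I Theorem 4.10 (proof)] -/
theorem exists_obstruction_eq_of_forall_shift (x : Ext S.X₃ T.X₁ 2)
    (hA : (Ext.mk₀ S.g).comp x (zero_add 2) = 0)
    (hB : ∀ y : Ext S.X₁ T.X₁ 1, hS.extClass.comp y (rfl : 1 + 1 = 2) = x → y.comp (Ext.mk₀ T.f) (add_zero 1) = 0) :
    ∃ h : S.X₁ ⟶ T.X₃, obstruction hS hT h = x := by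
  obtain ⟨y, hy⟩ := exists_shift_of_mk₀_g_comp_eq_zero hS x hA
  exact exists_obstruction_eq_of_shift hS hT x y hy (hB y hy)

/-- **Image of `Ψ`**: `x ∈ Im Ψ` iff (A) `x ∘ π = 0` and (B) SOME shift `y` of `x` satisfies `y ∘ f = 0` (when
`Ext¹(P, X₁) = 0` the shift is unique, `shift_unique`). [cite: MilneADT2006, I Theorem 4.10 (proof)] [cite: Weibel1994, Theorem 2.7.6] -/
theorem exists_obstruction_eq_iff (x : Ext S.X₃ T.X₁ 2) :
    (∃ h : S.X₁ ⟶ T.X₃, obstruction hS hT h = x) ↔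
      (Ext.mk₀ S.g).comp x (zero_add 2) = 0 ∧
        ∃ y : Ext S.X₁ T.X₁ 1, hS.extClass.comp y (rfl : 1 + 1 = 2) = x ∧ y.comp (Ext.mk₀ T.f) (add_zero 1) = 0 := by
  constructor
  · rintro ⟨h, rfl⟩
    refine ⟨mk₀_g_comp_obstruction hS hT h, (Ext.mk₀ h).comp hT.extClass (zero_add 1), rfl, ?_⟩
    exact shift_obstruction_comp_mk₀_f hT h
  · rintro ⟨-, y, hy, hB⟩
    exact exists_obstruction_eq_of_shift hS hT x y hy hB

include hS in
/-- Under `Ext¹(P, X₁) = 0`, condition (B) for ONE shift gives it for all (they coincide).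
[cite: Weibel1994, Theorem 2.7.6] -/
theorem comp_mk₀_f_eq_zero_of_shift (hP : ∀ z : Ext S.X₂ T.X₁ 1, z = 0) {x : Ext S.X₃ T.X₁ 2}
    {y₀ : Ext S.X₁ T.X₁ 1} (hy₀ : hS.extClass.comp y₀ (rfl : 1 + 1 = 2) = x)
    (hB₀ : y₀.comp (Ext.mk₀ T.f) (add_zero 1) = 0) (y : Ext S.X₁ T.X₁ 1)
    (hy : hS.extClass.comp y (rfl : 1 + 1 = 2) = x) : y.comp (Ext.mk₀ T.f) (add_zero 1) = 0 := by
  rw [shift_unique hS hP (hy.trans hy₀.symm)]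
  exact hB₀

end ExtPresentation

end Literature.Algebra.Homology

end
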